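import Summits.QuantumAdvantage.AdviceFreeQNC0.CrossCellSteps
import HarnessLib

/-!
# Cell qa-qnc0 (rung F-Q1, route RingFrame, crux α `RingToElim`): the CROSS-CELL OBSTRUCTION —
# a doubly-even low-degree cell family cannot track two arbitrary even block triples

Data on a window content `w = x ++ z` (`x ∈ {0,1}^L`, `z ∈ {0,1}^M`; `i = |x|`, `j = |z|` mod
`3`, `ρ = i + j`, `σ = 2i + j`):

* a CELL FAMILY `Θ_ij` (`i, j ∈ ℤ/3`) of Boolean functions of `𝔽₂`-degree `≤ D` on `{0,1}^{L+M}`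
  which is DOUBLY EVEN: `⊕_j Θ_ij ≡ 0` for each `i` and `⊕_i Θ_ij ≡ 0` for each `j` (every walk
  position whose character is constant on cells contributes `y_g(w)·[character ≠ 0]`, and the
  character, a function of `ρ` or of `σ`, vanishes for exactly one of the three cells of each row
  and of each column);
* ARBITRARY even triples `A_r` on `{0,1}^L`, `B_r` on `{0,1}^M`;
* the win bit `W(x ++ z) = Θ_ij(w) ⊕ A_ρ(x) ⊕ B_σ(z)`.

* `crossCell_obstruction` — **there are `η₁, c₁ > 0`, `n₀` such that for `L, M ≥ n₀`,
  `D ≤ c₁√L, c₁√M`: `#{w : W w} ≤ (1 − η₁)·2^{L+M}`.**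

Proof (simpler than `cellParity_obstruction`, and stronger).  If the failure set is tiny, slices
and globalisation (`CrossCellSteps.lean`) give degree-`D` functions with
`Θ_ij = ¬(α_ij(x) ⊕ β_ij(z))` almost everywhere, `α_ij ≈ A_{i+j}` on class `i`, `β_ij ≈ B_{2i+j}`
on class `j`.  XOR over a ROW `i` kills `Θ` (`⊕_j Θ_ij = 0`):
`(⊕_j α_ij)(x) ⊕ (⊕_j β_ij)(z) ≈ 1`, so `⊕_j α_ij ≈ λ_i` is nearly constant
(`exists_const_of_xor_small`); XOR over a COLUMN `j`: `⊕_i α_ij ≈ κ_j`, `⊕_i β_ij ≈ ¬κ_j`.  At a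
good `x` of class `i`, evenness of `A` gives `λ_i = ⊕_j A_{i+j}(x) = 0`; at a good `z` of class
`j`, evenness of `B` gives `¬κ_j = ⊕_i B_{2i+j}(z) = 0`.  Then at any good `x`,
`⊕_{ij} α_ij(x) = ⊕_i λ_i = 0` and `= ⊕_j κ_j = 1`.

The cell's statement (prover qn-prover-3, 2026-08-27); not in print.  WHAT THIS IS NOT: no walk
strategies here (see `CrossFreeWindow.lean`); `η₁` is tiny; no separation.

## References

* S. Srinivasan, *A robust version of Hegedűs's lemma, with applications*, TheoretiCS 2 (2023),
  Lemma 3.1 [Srinivasan2023] (through `lowDeg_cell_extension`).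
-/

noncomputable section

namespace Summit.QuantumAdvantage.AdviceFreeQNC0

open Finset
open Literature.Computability.MetaComplexity Literature.Computability.MetaComplexity.Smolensky

variable {L M D : ℕ}

/-! ### Tools -/

/-- A union bound over three alternatives (three predicates, real form). -/
private theorem card_filter_or3_le_real' {α : Type*} [Fintype α] [DecidableEq α]
    (P Q R : α → Prop) [DecidablePred P] [DecidablePred Q] [DecidablePred R] :
    ((univ.filter fun x : α => P x ∨ Q x ∨ R x).card : ℝ) ≤
      ((univ.filter fun x => P x).card : ℝ) + ((univ.filter fun x => Q x).card : ℝ) +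
        ((univ.filter fun x => R x).card : ℝ) := by
  have h1 := card_filter_or_le_real (fun x => P x) (fun x => Q x ∨ R x)
  have h2 := card_filter_or_le_real (fun x => Q x) (fun x => R x)
  linarith

/-- A point of a prescribed class outside a small exceptional set (`L ≥ 3`: classes have
`≥ 2^L/4` elements). -/
private theorem exists_class_avoid {L : ℕ} (hL : 3 ≤ L) (bad : (Fin L → Bool) → Prop)
    [DecidablePred bad] {c : ℝ}
    (hbad : ((univ.filter fun x : Fin L → Bool => bad x).card : ℝ) ≤ c * (2 : ℝ) ^ L)
    (hc : 4 * c < 1) (i : ℕ) : ∃ x : Fin L → Bool, wt x % 3 = i % 3 ∧ ¬ bad x := by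
  by_contra hnone
  push Not at hnone
  have hcls := four_mul_card_class_ge hL i
  have hsub : ((univ.filter fun x : Fin L → Bool => wt x % 3 = i % 3).card : ℝ) ≤
      ((univ.filter fun x : Fin L → Bool => bad x).card : ℝ) :=
    card_filter_mono_real _ _ hnone
  have hclsR : ((2 : ℝ) ^ L) ≤ 4 * ((univ.filter fun x : Fin L → Bool => wt x % 3 = i % 3).card : ℝ) := by
    exact_mod_cast hcls
  have hpos : (0 : ℝ) < (2 : ℝ) ^ L := by positivity
  nlinarith

/-- Row evenness of `A` read through the slices: for `i < 3`, if `α_ij = A_{(i+j) mod 3}` at `x`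
for `j = 0, 1, 2`, then `⊕_j α_ij(x) = 0`. -/
private theorem xor_row_zero {i : ℕ} (hi : i < 3) {A : ℕ → (Fin L → Bool) → Bool}
    {α : ℕ → ℕ → (Fin L → Bool) → Bool} {x : Fin L → Bool}
    (hAe : xor (A 0 x) (xor (A 1 x) (A 2 x)) = false)
    (h0 : α i 0 x = A ((i + 0) % 3) x) (h1 : α i 1 x = A ((i + 1) % 3) x)
    (h2 : α i 2 x = A ((i + 2) % 3) x) :
    xor (α i 0 x) (xor (α i 1 x) (α i 2 x)) = false := by
  rw [h0, h1, h2]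
  interval_cases i
  · simpa using hAe
  · simp only [Nat.reduceAdd, Nat.reduceMod]
    revert hAe; cases A 0 x <;> cases A 1 x <;> cases A 2 x <;> decide
  · simp only [Nat.reduceAdd, Nat.reduceMod]
    revert hAe; cases A 0 x <;> cases A 1 x <;> cases A 2 x <;> decide

/-- Column evenness of `B` read through the slices: for `j < 3`, if `β_ij = B_{(2i+j) mod 3}` at
`z` for `i = 0, 1, 2`, then `⊕_i β_ij(z) = 0`. -/
private theorem xor_col_zero {j : ℕ} (hj : j < 3) {B : ℕ → (Fin M → Bool) → Bool}
    {β : ℕ → ℕ → (Fin M → Bool) → Bool} {z : Fin M → Bool}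
    (hBe : xor (B 0 z) (xor (B 1 z) (B 2 z)) = false)
    (h0 : β 0 j z = B ((2 * 0 + j) % 3) z) (h1 : β 1 j z = B ((2 * 1 + j) % 3) z)
    (h2 : β 2 j z = B ((2 * 2 + j) % 3) z) :
    xor (β 0 j z) (xor (β 1 j z) (β 2 j z)) = false := by
  rw [h0, h1, h2]
  interval_cases j
  · simp only [Nat.reduceMul, Nat.reduceAdd, Nat.reduceMod]
    revert hBe; cases B 0 z <;> cases B 1 z <;> cases B 2 z <;> decide
  · simp only [Nat.reduceMul, Nat.reduceAdd, Nat.reduceMod]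
    revert hBe; cases B 0 z <;> cases B 1 z <;> cases B 2 z <;> decide
  · simp only [Nat.reduceMul, Nat.reduceAdd, Nat.reduceMod]
    revert hBe; cases B 0 z <;> cases B 1 z <;> cases B 2 z <;> decide

/-- The final parity contradiction: nine Booleans whose row XORs are all `0` and whose column
XORs are all `1` do not exist. -/
private theorem rows_zero_cols_one (a : ℕ → ℕ → Bool)
    (hrow : ∀ i, i < 3 → xor (a i 0) (xor (a i 1) (a i 2)) = false)
    (hcol : ∀ j, j < 3 → xor (a 0 j) (xor (a 1 j) (a 2 j)) = true) : False := by
  have r0 := hrow 0 (by norm_num); have r1 := hrow 1 (by norm_num); have r2 := hrow 2 (by norm_num)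
  have c0 := hcol 0 (by norm_num); have c1 := hcol 1 (by norm_num); have c2 := hcol 2 (by norm_num)
  revert r0 r1 r2 c0 c1 c2
  generalize a 0 0 = b00; generalize a 0 1 = b01; generalize a 0 2 = b02
  generalize a 1 0 = b10; generalize a 1 1 = b11; generalize a 1 2 = b12
  generalize a 2 0 = b20; generalize a 2 1 = b21; generalize a 2 2 = b22
  cases b00 <;> cases b01 <;> cases b02 <;> cases b10 <;> cases b11 <;> cases b12 <;>
    cases b20 <;> cases b21 <;> cases b22 <;> decide

/-! ### The theorem -/

/-- **THE CROSS-CELL OBSTRUCTION.**  There are `η₁ > 0`, `c₁ > 0` and `n₀` such that for all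
`L, M ≥ n₀`, all `D ≤ c₁√L`, `D ≤ c₁√M`, every DOUBLY-EVEN cell family `Θ_ij` of Boolean
functions of `𝔽₂`-degree `≤ D` on `{0,1}^{L+M}`, all even triples `A` (on `{0,1}^L`), `B` (on
`{0,1}^M`) of ARBITRARY Boolean functions, and every `W` given on `w = x ++ z` by
`W = Θ_ij(w) ⊕ A_ρ(x) ⊕ B_σ(z)` (`i = |x|`, `j = |z|`, `ρ = i + j`, `σ = 2i + j` mod `3`):
`#{w : W w} ≤ (1 − η₁)·2^{L+M}`.  (Cell statement, prover qn-prover-3;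
`η₁ = min(ε_T/9, 1/2000)` with `ε_T` from `lowDeg_cell_extension` at `γ = 1/200`.)
[cite: Srinivasan2023, Lemma 3.1] -/
theorem crossCell_obstruction :
    ∃ η₁ : ℝ, 0 < η₁ ∧ ∃ c₁ : ℝ, 0 < c₁ ∧ ∃ n₀ : ℕ, ∀ L M : ℕ, n₀ ≤ L → n₀ ≤ M →
      ∀ D : ℕ, (D : ℝ) ≤ c₁ * Real.sqrt L → (D : ℝ) ≤ c₁ * Real.sqrt M →
      ∀ (Θ : ℕ → ℕ → (Fin (L + M) → Bool) → Bool) (A : ℕ → (Fin L → Bool) → Bool)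
        (B : ℕ → (Fin M → Bool) → Bool) (W : (Fin (L + M) → Bool) → Bool),
        (∀ i j, HasDeg (Θ i j) D) →
        (∀ i w, i < 3 → xor (Θ i 0 w) (xor (Θ i 1 w) (Θ i 2 w)) = false) →
        (∀ j w, j < 3 → xor (Θ 0 j w) (xor (Θ 1 j w) (Θ 2 j w)) = false) →
        (∀ x, xor (A 0 x) (xor (A 1 x) (A 2 x)) = false) →
        (∀ z, xor (B 0 z) (xor (B 1 z) (B 2 z)) = false) →
        (∀ (x : Fin L → Bool) (z : Fin M → Bool), W (Fin.append x z) =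
          xor (Θ (wt x % 3) (wt z % 3) (Fin.append x z))
            (xor (A ((wt x + wt z) % 3) x) (B ((2 * wt x + wt z) % 3) z))) →
        ((univ.filter fun w : Fin (L + M) → Bool => W w = true).card : ℝ) ≤
          (1 - η₁) * (2 : ℝ) ^ (L + M) := by
  obtain ⟨εT, hεT, c₁, hc₁, n₁, hT⟩ := lowDeg_cell_extension (1 / 200) (by norm_num)
  refine ⟨min (εT / 9) (1 / 2000), lt_min (by positivity) (by norm_num), c₁, hc₁, max n₁ 3, ?_⟩
  intro L M hL hM D hDL hDM Θ A B W hΘ hΘrow hΘcol hAe hBe hW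
  set ε₀ : ℝ := min (εT / 9) (1 / 2000) with hε₀
  have hε₀T : 9 * ε₀ ≤ εT := by
    have : ε₀ ≤ εT / 9 := min_le_left _ _
    linarith
  have hε₀s : ε₀ ≤ 1 / 2000 := min_le_right _ _
  have hL3 : 3 ≤ L := le_trans (le_max_right _ _) hL
  have hM3 : 3 ≤ M := le_trans (le_max_right _ _) hM
  have hn₁L : n₁ ≤ L := le_trans (le_max_left _ _) hL
  have hn₁M : n₁ ≤ M := le_trans (le_max_left _ _) hM
  set N : ℝ := (2 : ℝ) ^ (L + M) with hN
  -- wins and failures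
  have hsplit : ((univ.filter fun w : Fin (L + M) → Bool => W w = true).card : ℝ) +
      ((univ.filter fun w : Fin (L + M) → Bool => W w = false).card : ℝ) = N := by
    have h := Finset.card_filter_add_card_filter_not (s := (univ : Finset (Fin (L + M) → Bool)))
      (fun w => W w = true)
    have h2 : (univ.filter fun w : Fin (L + M) → Bool => ¬ W w = true) =
        univ.filter fun w : Fin (L + M) → Bool => W w = false :=
      Finset.filter_congr fun w _ => by simp
    rw [h2, Finset.card_univ, Fintype.card_fun, Fintype.card_bool, Fintype.card_fin] at h
    rw [hN]; exact_mod_cast h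
  by_contra hcon
  have hfail : ((univ.filter fun w : Fin (L + M) → Bool => W w = false).card : ℝ) ≤ ε₀ * N := by
    push Not at hcon
    linarith
  -- Steps 1–2
  choose α hαdeg hαA using fun i j => crossCell_row_approx (D := D) hW hΘ hM3 hfail i j
  choose β hβdeg hβB using fun i j => crossCell_col_approx (D := D) hW hΘ hL3 hfail i j
  have hT' := hT L M hn₁L hn₁M D hDL hDM
  have hG : ∀ i j : ℕ, ((univ.filter fun w : Fin (L + M) → Bool =>
      Θ (i % 3) (j % 3) w ≠ !(xor (α i j (fun i : Fin L => w (Fin.castAdd M i)))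
        (β i j (fun j : Fin M => w (Fin.natAdd L j))))).card : ℝ) ≤ 1 / 200 * N :=
    fun i j => crossCell_globalise (D := D) hW hΘ hε₀T hT' hfail i j (hαdeg i j) (hβdeg i j)
      (hαA i j) (hβB i j)
  -- Step 3: rows and columns
  have hrow : ∀ i : ℕ, i < 3 → ∃ lam : Bool,
      ((univ.filter fun x : Fin L → Bool =>
        xor (α i 0 x) (xor (α i 1 x) (α i 2 x)) ≠ lam).card : ℝ) ≤ 3 / 200 * (2 : ℝ) ^ L ∧
      ((univ.filter fun z : Fin M → Bool =>
        (!(xor (β i 0 z) (xor (β i 1 z) (β i 2 z)))) ≠ lam).card : ℝ) ≤ 3 / 200 * (2 : ℝ) ^ M := by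
    intro i hi
    refine exists_const_of_xor_small _ _ (by norm_num) ?_
    -- off the three exceptional sets, the row XOR of the identities
    have hsub : ∀ w : Fin (L + M) → Bool,
        xor (xor (α i 0 (fun i : Fin L => w (Fin.castAdd M i)))
              (xor (α i 1 (fun i : Fin L => w (Fin.castAdd M i)))
                (α i 2 (fun i : Fin L => w (Fin.castAdd M i)))))
            (!(xor (β i 0 (fun j : Fin M => w (Fin.natAdd L j)))
              (xor (β i 1 (fun j : Fin M => w (Fin.natAdd L j)))
                (β i 2 (fun j : Fin M => w (Fin.natAdd L j)))))) = true →
        (Θ (i % 3) (0 % 3) w ≠ !(xor (α i 0 (fun i : Fin L => w (Fin.castAdd M i)))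
            (β i 0 (fun j : Fin M => w (Fin.natAdd L j)))) ∨
        (Θ (i % 3) (1 % 3) w ≠ !(xor (α i 1 (fun i : Fin L => w (Fin.castAdd M i)))
            (β i 1 (fun j : Fin M => w (Fin.natAdd L j)))) ∨
        Θ (i % 3) (2 % 3) w ≠ !(xor (α i 2 (fun i : Fin L => w (Fin.castAdd M i)))
            (β i 2 (fun j : Fin M => w (Fin.natAdd L j)))))) := by
      intro w hw
      by_contra hcon'
      push Not at hcon'
      obtain ⟨h0, h1, h2⟩ := hcon'
      have hev := hΘrow (i % 3) w (Nat.mod_lt _ (by norm_num))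
      simp only [Nat.zero_mod, Nat.one_mod, Nat.reduceMod] at h0 h1 h2
      rw [h0, h1, h2] at hev
      revert hw hev
      cases α i 0 (fun i : Fin L => w (Fin.castAdd M i)) <;>
        cases α i 1 (fun i : Fin L => w (Fin.castAdd M i)) <;>
        cases α i 2 (fun i : Fin L => w (Fin.castAdd M i)) <;>
        cases β i 0 (fun j : Fin M => w (Fin.natAdd L j)) <;>
        cases β i 1 (fun j : Fin M => w (Fin.natAdd L j)) <;>
        cases β i 2 (fun j : Fin M => w (Fin.natAdd L j)) <;> decide
    have h1 := card_filter_mono_real _ _ hsub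
    have h2 := card_filter_or3_le_real (fun k (w : Fin (L + M) → Bool) =>
      Θ (i % 3) (k % 3) w ≠ !(xor (α i k (fun i : Fin L => w (Fin.castAdd M i)))
        (β i k (fun j : Fin M => w (Fin.natAdd L j)))))
    have g0 := hG i 0; have g1 := hG i 1; have g2 := hG i 2
    rw [hN] at g0 g1 g2
    linarith
  have hcol : ∀ j : ℕ, j < 3 → ∃ kap : Bool,
      ((univ.filter fun x : Fin L → Bool =>
        xor (α 0 j x) (xor (α 1 j x) (α 2 j x)) ≠ kap).card : ℝ) ≤ 3 / 200 * (2 : ℝ) ^ L ∧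
      ((univ.filter fun z : Fin M → Bool =>
        (!(xor (β 0 j z) (xor (β 1 j z) (β 2 j z)))) ≠ kap).card : ℝ) ≤ 3 / 200 * (2 : ℝ) ^ M := by
    intro j hj
    refine exists_const_of_xor_small _ _ (by norm_num) ?_
    have hsub : ∀ w : Fin (L + M) → Bool,
        xor (xor (α 0 j (fun i : Fin L => w (Fin.castAdd M i)))
              (xor (α 1 j (fun i : Fin L => w (Fin.castAdd M i)))
                (α 2 j (fun i : Fin L => w (Fin.castAdd M i)))))
            (!(xor (β 0 j (fun j : Fin M => w (Fin.natAdd L j)))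
              (xor (β 1 j (fun j : Fin M => w (Fin.natAdd L j)))
                (β 2 j (fun j : Fin M => w (Fin.natAdd L j)))))) = true →
        (Θ (0 % 3) (j % 3) w ≠ !(xor (α 0 j (fun i : Fin L => w (Fin.castAdd M i)))
            (β 0 j (fun j : Fin M => w (Fin.natAdd L j)))) ∨
        (Θ (1 % 3) (j % 3) w ≠ !(xor (α 1 j (fun i : Fin L => w (Fin.castAdd M i)))
            (β 1 j (fun j : Fin M => w (Fin.natAdd L j)))) ∨
        Θ (2 % 3) (j % 3) w ≠ !(xor (α 2 j (fun i : Fin L => w (Fin.castAdd M i)))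
            (β 2 j (fun j : Fin M => w (Fin.natAdd L j)))))) := by
      intro w hw
      by_contra hcon'
      push Not at hcon'
      obtain ⟨h0, h1, h2⟩ := hcon'
      have hev := hΘcol (j % 3) w (Nat.mod_lt _ (by norm_num))
      simp only [Nat.zero_mod, Nat.one_mod, Nat.reduceMod] at h0 h1 h2
      rw [h0, h1, h2] at hev
      revert hw hev
      cases α 0 j (fun i : Fin L => w (Fin.castAdd M i)) <;>
        cases α 1 j (fun i : Fin L => w (Fin.castAdd M i)) <;>
        cases α 2 j (fun i : Fin L => w (Fin.castAdd M i)) <;>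
        cases β 0 j (fun j : Fin M => w (Fin.natAdd L j)) <;>
        cases β 1 j (fun j : Fin M => w (Fin.natAdd L j)) <;>
        cases β 2 j (fun j : Fin M => w (Fin.natAdd L j)) <;> decide
    have h1 := card_filter_mono_real _ _ hsub
    have h2 := card_filter_or3_le_real (fun k (w : Fin (L + M) → Bool) =>
      Θ (k % 3) (j % 3) w ≠ !(xor (α k j (fun i : Fin L => w (Fin.castAdd M i)))
        (β k j (fun j : Fin M => w (Fin.natAdd L j)))))
    have g0 := hG 0 j; have g1 := hG 1 j; have g2 := hG 2 j
    rw [hN] at g0 g1 g2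
    linarith
  choose lam hlamX hlamZ using hrow
  choose kap hkapX hkapZ using hcol
  -- Step 4: `λ_i = 0` from a good `x` of class `i`
  have hlam0 : ∀ i (hi : i < 3), lam i hi = false := by
    intro i hi
    have hbad : ((univ.filter fun x : Fin L → Bool =>
        (wt x % 3 = i % 3 ∧ A ((i + 0) % 3) x ≠ α i 0 x) ∨
        (wt x % 3 = i % 3 ∧ A ((i + 1) % 3) x ≠ α i 1 x) ∨
        ((wt x % 3 = i % 3 ∧ A ((i + 2) % 3) x ≠ α i 2 x) ∨
          xor (α i 0 x) (xor (α i 1 x) (α i 2 x)) ≠ lam i hi)).card : ℝ) ≤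
        (12 * ε₀ + 3 / 200) * (2 : ℝ) ^ L := by
      have h1 := card_filter_or3_le_real'
        (fun x : Fin L → Bool => wt x % 3 = i % 3 ∧ A ((i + 0) % 3) x ≠ α i 0 x)
        (fun x : Fin L → Bool => wt x % 3 = i % 3 ∧ A ((i + 1) % 3) x ≠ α i 1 x)
        (fun x : Fin L → Bool => (wt x % 3 = i % 3 ∧ A ((i + 2) % 3) x ≠ α i 2 x) ∨
            xor (α i 0 x) (xor (α i 1 x) (α i 2 x)) ≠ lam i hi)
      have h2 := card_filter_or_le_real (fun x : Fin L → Bool => wt x % 3 = i % 3 ∧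
          A ((i + 2) % 3) x ≠ α i 2 x)
        (fun x => xor (α i 0 x) (xor (α i 1 x) (α i 2 x)) ≠ lam i hi)
      have a0 := hαA i 0; have a1 := hαA i 1; have a2 := hαA i 2
      have hl := hlamX i hi
      linarith
    obtain ⟨x, hxi, hgood⟩ := exists_class_avoid hL3 _ hbad (by nlinarith) i
    simp only [not_or, not_and, ne_eq, not_not] at hgood
    obtain ⟨h0, h1, h2, h3⟩ := hgood
    rw [← h3]
    exact xor_row_zero hi (hAe x) (h0 hxi).symm (h1 hxi).symm (h2 hxi).symm
  -- `κ_j = 1` from a good `z` of class `j`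
  have hkap1 : ∀ j (hj : j < 3), kap j hj = true := by
    intro j hj
    have hbad : ((univ.filter fun z : Fin M → Bool =>
        (wt z % 3 = j % 3 ∧ B ((2 * 0 + j) % 3) z ≠ β 0 j z) ∨
        (wt z % 3 = j % 3 ∧ B ((2 * 1 + j) % 3) z ≠ β 1 j z) ∨
        ((wt z % 3 = j % 3 ∧ B ((2 * 2 + j) % 3) z ≠ β 2 j z) ∨
          (!(xor (β 0 j z) (xor (β 1 j z) (β 2 j z)))) ≠ kap j hj)).card : ℝ) ≤
        (12 * ε₀ + 3 / 200) * (2 : ℝ) ^ M := by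
      have h1 := card_filter_or3_le_real'
        (fun z : Fin M → Bool => wt z % 3 = j % 3 ∧ B ((2 * 0 + j) % 3) z ≠ β 0 j z)
        (fun z : Fin M → Bool => wt z % 3 = j % 3 ∧ B ((2 * 1 + j) % 3) z ≠ β 1 j z)
        (fun z : Fin M → Bool => (wt z % 3 = j % 3 ∧ B ((2 * 2 + j) % 3) z ≠ β 2 j z) ∨
            (!(xor (β 0 j z) (xor (β 1 j z) (β 2 j z)))) ≠ kap j hj)
      have h2 := card_filter_or_le_real (fun z : Fin M → Bool => wt z % 3 = j % 3 ∧
          B ((2 * 2 + j) % 3) z ≠ β 2 j z)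
        (fun z => (!(xor (β 0 j z) (xor (β 1 j z) (β 2 j z)))) ≠ kap j hj)
      have b0 := hβB 0 j; have b1 := hβB 1 j; have b2 := hβB 2 j
      have hk := hkapZ j hj
      linarith
    obtain ⟨z, hzj, hgood⟩ := exists_class_avoid hM3 _ hbad (by nlinarith) j
    simp only [not_or, not_and, ne_eq, not_not] at hgood
    obtain ⟨h0, h1, h2, h3⟩ := hgood
    rw [← h3, xor_col_zero hj (hBe z) (h0 hzj).symm (h1 hzj).symm (h2 hzj).symm]
    rfl
  -- the contradiction at any `x` avoiding the six separation sets
  have hbad6 : ((univ.filter fun x : Fin L → Bool =>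
      (xor (α 0 0 x) (xor (α 0 1 x) (α 0 2 x)) ≠ lam 0 (by norm_num) ∨
        xor (α 0 0 x) (xor (α 1 0 x) (α 2 0 x)) ≠ kap 0 (by norm_num)) ∨
      (xor (α 1 0 x) (xor (α 1 1 x) (α 1 2 x)) ≠ lam 1 (by norm_num) ∨
        xor (α 0 1 x) (xor (α 1 1 x) (α 2 1 x)) ≠ kap 1 (by norm_num)) ∨
      (xor (α 2 0 x) (xor (α 2 1 x) (α 2 2 x)) ≠ lam 2 (by norm_num) ∨
        xor (α 0 2 x) (xor (α 1 2 x) (α 2 2 x)) ≠ kap 2 (by norm_num))).card : ℝ) ≤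
      (18 / 200) * (2 : ℝ) ^ L := by
    have h1 := card_filter_or3_le_real'
      (fun x : Fin L → Bool => xor (α 0 0 x) (xor (α 0 1 x) (α 0 2 x)) ≠ lam 0 (by norm_num) ∨
          xor (α 0 0 x) (xor (α 1 0 x) (α 2 0 x)) ≠ kap 0 (by norm_num))
      (fun x : Fin L → Bool => xor (α 1 0 x) (xor (α 1 1 x) (α 1 2 x)) ≠ lam 1 (by norm_num) ∨
          xor (α 0 1 x) (xor (α 1 1 x) (α 2 1 x)) ≠ kap 1 (by norm_num))
      (fun x : Fin L → Bool => xor (α 2 0 x) (xor (α 2 1 x) (α 2 2 x)) ≠ lam 2 (by norm_num) ∨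
          xor (α 0 2 x) (xor (α 1 2 x) (α 2 2 x)) ≠ kap 2 (by norm_num))
    have e0 := card_filter_or_le_real
      (fun x : Fin L → Bool => xor (α 0 0 x) (xor (α 0 1 x) (α 0 2 x)) ≠ lam 0 (by norm_num))
      (fun x => xor (α 0 0 x) (xor (α 1 0 x) (α 2 0 x)) ≠ kap 0 (by norm_num))
    have e1 := card_filter_or_le_real
      (fun x : Fin L → Bool => xor (α 1 0 x) (xor (α 1 1 x) (α 1 2 x)) ≠ lam 1 (by norm_num))
      (fun x => xor (α 0 1 x) (xor (α 1 1 x) (α 2 1 x)) ≠ kap 1 (by norm_num))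
    have e2 := card_filter_or_le_real
      (fun x : Fin L → Bool => xor (α 2 0 x) (xor (α 2 1 x) (α 2 2 x)) ≠ lam 2 (by norm_num))
      (fun x => xor (α 0 2 x) (xor (α 1 2 x) (α 2 2 x)) ≠ kap 2 (by norm_num))
    have l0 := hlamX 0 (by norm_num); have l1 := hlamX 1 (by norm_num); have l2 := hlamX 2 (by norm_num)
    have k0 := hkapX 0 (by norm_num); have k1 := hkapX 1 (by norm_num); have k2 := hkapX 2 (by norm_num)
    linarith
  obtain ⟨x, -, hgood⟩ := exists_class_avoid hL3 _ hbad6 (by norm_num) 0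
  simp only [not_or, ne_eq, not_not] at hgood
  obtain ⟨⟨r0, c0⟩, ⟨r1, c1⟩, ⟨r2, c2⟩⟩ := hgood
  rw [hlam0] at r0 r1 r2
  rw [hkap1] at c0 c1 c2
  exact rows_zero_cols_one (fun i j => α i j x)
    (fun i hi => by interval_cases i <;> assumption)
    (fun j hj => by interval_cases j <;> assumption)

end Summit.QuantumAdvantage.AdviceFreeQNC0
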